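import Summits.AnomalousDissipation.AnomalousDissipation.Theses.MirrorVariety
import Literature.Analysis.FluidPDE.SteadyGalerkinApprox
import Literature.Analysis.FunctionSpaces.TorusIntegerEndomorphism

/-!
# Disproof of `TaylorGreenLoudGalerkinStates` — standing adversary's work file

Crux `stmt-AnomalousDissipation-2987` = `Summit.AnomalousDissipation.AnomalousDissipation.Theses.MirrorVariety.TaylorGreenLoudGalerkinStates`
(route `MirrorVariety`, rank 2, "hardest"): for the Taylor–Green force `f_TG` there are `ν_j → 0⁺`, `E`, `ε > 0`
such that for every `j` and ALL large resolutions `N` there is a smooth div-free mean-zero Fourier–Galerkin steady state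
`U` band-limited to `0 < |k|² ≤ N²`, solving the tested Galerkin equations, with `∫|U|² ≤ E` and `ν_j‖∇U‖² ≥ ε`.

## Findings (cycle 1, refuter-cdisprove-stmt-AnomalousDissipation-2987-0, 2026-08-16) — NO KILL

* §0 `crux_iff` — the `∀ f, f = f_TG →` binder is sugar: crux ↔ `LoudBoundedStates tgForce`.
* §1 `energy_identity` — every admissible state satisfies the EXACT injection identity `ν‖∇U‖² = ∫⟪f, U⟫`
  (test with `a := U`; antisymmetry of the trilinear form + Green). All negative lemmas below are corollaries.
* §2 LOAD-BEARING ANALYSIS (each `…_false_without_…` / `not_…` is sorry-free):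
  (a) the force: `taylorGreenLoud_false_without_force` — the conclusion fails for `f = 0` (loudness = injection = 0);
      any proof must use `f_TG ≠ 0` quantitatively (through (b)).
  (b) the constants: `loudness_le_sqrt_energy` — `ν‖∇U‖² ≤ √(∫|U|²)` for `f_TG` (`‖f_TG(x)‖ ≤ 1` pointwise), hence
      `not_loud_of_energy_lt_sq` — the strengthening with `E < ε²` is FALSE.
  (b♯) SHARP form via the Fourier support of `f_TG`: `tgForce_eq_realTrigPoly` (explicit coefficients
      `f̂(k) = (i/8)(−k₀,k₁,0)` on the 8-point shell `|k|² = 3`; whence `isSmooth/isDivFree/hasZeroMean_tgForce`,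
      `integral_norm_sq_tgForce = 1/4`, `mFourierCoeff_tgForce`), `integral_inner_tgForce_eq_sum` (injection is carried
      by the shell), `loudness_le_half_sqrt_shellEnergy`, `loudness_le_half_sqrt_energy` (`ν‖∇U‖² ≤ ½√E`),
      `not_loud_of_energy_lt_four_sq` (`E < 4ε²` FALSE — sharp window), `shell_energy_floor` (a witness keeps energy
      `≥ 4ε²` on the forcing shell).
  (c) the resolution: `gradNormSq_le_of_isBandLimited` (Bernstein, `‖∇U‖² ≤ 4π²N²∫|U|²`) ⟹ `resolution_floor`
      (`ε ≤ 4π²ν N²E`: witnesses live on the diagonal `N ≥ (ε/4π²Eν_j)^{1/2} → ∞`), `not_loud_at_fixed_resolution`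
      (∃ N ∀ j: FALSE for EVERY force) and `not_loud_uniformly_in_resolution` (the quantifier swap `∀ᶠ N, ∀ j` is FALSE):
      the order `∀ j, ∀ᶠ N` with a `j`-dependent threshold is essential.
  (c') `gradNormSq_le_low_add_high`, `high_mode_dissipation_floor` — for every cutoff `K`, a loud bounded state
      dissipates `≥ ε − 4π²νK²E` in the modes `|k| > K`: half the dissipation sits at `|k| > (ε/8π²νE)^{1/2} → ∞`.
      Together with (b♯): every witness is a genuine cascade state (amplitude `≥ 2ε` on `|k|² = 3`, enstrophy at
      `|k| ≳ ν^{-1/2}`), uniformly Onsager-rough in the limit (barrier `DrivasEyink2019_lemma1` as necessary signature).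
  (d) `not_loud_with_one_state` — a `j`-independent witness `U` is impossible (trivial, recorded for completeness).
* §3 `not_crux_iff` — what a refutation must prove, by pure logic: a UNIFORM-IN-`N` LAMINARISATION theorem for steady
  Galerkin TG states at bounded energy along every `ν_j → 0⁺` (= route CoherentStates' `SteadyNeg` at the Galerkin level,
  specialised to `f_TG`). No such theorem exists in print or in the tree in 3-D (the planar shadow is the catalogued barrier
  `AlexakisDoering2006_energyDissipationBound`, which `f_TG` evades by vortex stretching); no finite computation can refute an
  `∃ ν_j, ∃ E ε, ∀ j, ∀ᶠ N` statement. THIS is why the crux resists: it is the steady zeroth law for one explicit force,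
  an open problem in both directions.
* §4 Targets (line `stagnation-plug-froth`, stubs `stub_froth`, `stub_galerkinNewton`, `stub_criticality`, `stub_tgForceRegular`):
  no stuck stubs handed over yet; hand audit of the typed stubs found NO cheap kill — see the `Targets` section at the end
  for the per-stub reasoning (junk-parameter instances `v = 0`, `E₁ = 0`, `η = 0`, `M ≤ 0`, non-symmetric `f` all checked
  harmless; `stub_criticality` is true; `stub_galerkinNewton` is BRR + Kantorovich with a `ν`-independent Lipschitz
  constant, consistent with its universal `c`; `stub_froth` is the crux's open content; v2 stubs `stub_truncation`,
  `stub_discreteInfSup`, `stub_discreteKantorovich` audited 06:00Z: TRUE, no junk instance, jointly sufficient). POSITIVE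
  BY-PRODUCT (§4a): `stub_tgForceRegular` is fully PROVED (`isSmooth/isDivFree/hasZeroMean_tgForce` + `isKSymm_tgForce`; evidence
  `StubTGForceRegular.lean` compiles against the landed Line module).
* Negatives index (`ledger negatives`: 2859, 2979, 2984, 13037) and the barrier catalogue: nothing bites the crux as stated.

House rules: prose only in docstrings/comments; `sorry` only in the `NearMisses` section (none at present).
-/

noncomputable section

set_option linter.dupNamespace false

open scoped InnerProductSpace Topology ComplexConjugate
open MeasureTheory Filter
open Literature.Analysis.FunctionSpaces Literature.Analysis.FunctionSpaces.Torus

namespace Summit.AnomalousDissipation.AnomalousDissipation.Cruxes.TaylorGreenLoudGalerkinStates.Disproof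

/-! ## §0 Vocabulary (transparent restatements of the crux's own clauses) -/

/-- The Taylor–Green force of the crux, verbatim:
`f_TG = (sin2πx₀ cos2πx₁ cos2πx₂, −cos2πx₀ sin2πx₁ cos2πx₂, 0)` (`(fourier 1 t).im = sin 2πt`, `.re = cos 2πt`). -/
def tgForce : UnitAddTorus (Fin 3) → EuclideanSpace ℝ (Fin 3) := fun x =>
  !₂[(fourier 1 (x 0) : ℂ).im * (fourier 1 (x 1) : ℂ).re * (fourier 1 (x 2) : ℂ).re,
    -((fourier 1 (x 0) : ℂ).re * (fourier 1 (x 1) : ℂ).im * (fourier 1 (x 2) : ℂ).re), (0 : ℝ)]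

/-- Band-limitation to the punctured frequency ball `0 < |k|² ≤ N²` (verbatim the crux's clause). -/
def IsBandLimited (N : ℕ) (U : UnitAddTorus (Fin 3) → EuclideanSpace ℝ (Fin 3)) : Prop :=
  ∀ k ∉ (freqBall N).erase (0 : Fin 3 → ℤ),
    UnitAddTorus.mFourierCoeff (EuclideanSpace.complexify ∘ U) k = 0

/-- Admissible Galerkin steady state at `(ν, N)` for the force `f` — verbatim the bracket of the crux:
smooth, div-free, mean-zero, band-limited, and the tested Galerkin equations against every band-limited
smooth div-free test. -/
def IsSteadyState (ν : ℝ) (N : ℕ) (f U : UnitAddTorus (Fin 3) → EuclideanSpace ℝ (Fin 3)) : Prop :=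
  IsSmooth U ∧ IsDivFree U ∧ HasZeroMean U ∧ IsBandLimited N U ∧
    ∀ a : UnitAddTorus (Fin 3) → EuclideanSpace ℝ (Fin 3), IsSmooth a → IsDivFree a → IsBandLimited N a →
      ∫ x, (⟪U x, convect U a x⟫_ℝ + ν * ⟪U x, laplacian a x⟫_ℝ + ⟪f x, a x⟫_ℝ) = 0

/-- The crux's matrix: along `ν`, with constants `E`, `ε`, for every `j` and all large `N` a loud bounded state. -/
def LoudAlong (f : UnitAddTorus (Fin 3) → EuclideanSpace ℝ (Fin 3)) (ν : ℕ → ℝ) (E ε : ℝ) : Prop :=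
  ∀ j, ∀ᶠ N in atTop, ∃ U : UnitAddTorus (Fin 3) → EuclideanSpace ℝ (Fin 3),
    IsSteadyState (ν j) N f U ∧ ∫ x, ‖U x‖ ^ 2 ≤ E ∧ ε ≤ ν j * gradNormSq U

/-- The crux's conclusion for a general force `f`. -/
def LoudBoundedStates (f : UnitAddTorus (Fin 3) → EuclideanSpace ℝ (Fin 3)) : Prop :=
  ∃ (ν : ℕ → ℝ) (E ε : ℝ), (∀ j, 0 < ν j) ∧ Tendsto ν atTop (𝓝 0) ∧ 0 < ε ∧ LoudAlong f ν E ε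

/-- The `∀ f, f = f_TG → …` binder of the crux is sugar: crux ↔ its instance at `tgForce`. [folklore] -/
theorem crux_iff :
    Summit.AnomalousDissipation.AnomalousDissipation.Theses.MirrorVariety.TaylorGreenLoudGalerkinStates ↔
      LoudBoundedStates tgForce := by
  constructor
  · intro h
    exact h tgForce rfl
  · rintro h f rfl
    exact h

/-! ## §1 The exact energy (injection) identity of an admissible state -/

/-- The zero field is divergence free. [folklore] -/
theorem isDivFree_zero : IsDivFree (fun _ : UnitAddTorus (Fin 3) => (0 : EuclideanSpace ℝ (Fin 3))) := by
  intro x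
  simp [divergence, partialDeriv, Torus.lineDeriv]

/-- **Energy identity.** Every admissible Galerkin steady state at `(ν, N)` for a continuous force `f` satisfies
`ν ‖∇U‖² = ∫ ⟪f, U⟫` — test the equations with `a := U` (allowed: `U` is smooth, div-free, band-limited), use
the antisymmetry `∫⟪U,(U·∇)U⟫ = 0` and Green `∫⟪U, ΔU⟫ = −‖∇U‖²` (Temam 1979 Ch. II (1.29)). [folklore] -/
theorem energy_identity {ν : ℝ} {N : ℕ} {f U : UnitAddTorus (Fin 3) → EuclideanSpace ℝ (Fin 3)}
    (hU : IsSteadyState ν N f U) (hf : Continuous f) :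
    ν * gradNormSq U = ∫ x, ⟪f x, U x⟫_ℝ := by
  obtain ⟨hs, hdiv, -, hband, htest⟩ := hU
  have h := htest U hs hdiv hband
  have h1 : ∫ x, ⟪U x, convect U U x⟫_ℝ = 0 := by
    have ha := integral_inner_convect_eq_neg hs hdiv hs hs
    have hc : ∫ x, ⟪convect U U x, U x⟫_ℝ = ∫ x, ⟪U x, convect U U x⟫_ℝ :=
      integral_congr_ae (ae_of_all _ fun x => real_inner_comm _ _)
    linarith
  have h2 : ∫ x, ⟪U x, laplacian U x⟫_ℝ = -gradNormSq U := by
    have hint : ∀ i, Integrable (fun x => ‖partialDeriv i U x‖ ^ 2) volume := fun i =>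
      ((hs.partialDeriv i).continuous.norm.pow 2).integrable_unitAddTorus
    rw [integral_inner_laplacian_eq_neg_holds hs, gradNormSq, integral_finsetSum _ fun i _ => hint i]
  have i1 : Integrable (fun x => ⟪U x, convect U U x⟫_ℝ) volume := (hs.inner (hs.convect hs)).integrable
  have i2 : Integrable (fun x => ν * ⟪U x, laplacian U x⟫_ℝ) volume :=
    (hs.inner hs.laplacian).integrable.const_mul ν
  have i3 : Integrable (fun x => ⟪f x, U x⟫_ℝ) volume :=
    (hf.inner hs.continuous).integrable_unitAddTorus
  have i12 : Integrable (fun x => ⟪U x, convect U U x⟫_ℝ + ν * ⟪U x, laplacian U x⟫_ℝ) volume := i1.add i2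
  rw [integral_add i12 i3, integral_add i1 i2, integral_const_mul, h1, h2] at h
  linarith

/-! ## §2 Load-bearing analysis

### (a) The force hypothesis is load-bearing -/

/-- The crux with its only hypothesis (`f = f_TG`) dropped, i.e. weakened to "every smooth div-free mean-zero
force has loud bounded Galerkin steady states". -/
def TaylorGreenLoudGalerkinStatesWithoutForce : Prop :=
  ∀ f : UnitAddTorus (Fin 3) → EuclideanSpace ℝ (Fin 3), IsSmooth f → IsDivFree f → HasZeroMean f →
    LoudBoundedStates f

/-- No loud Galerkin steady states for the zero force: loudness equals injection, which vanishes. [folklore] -/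
theorem not_loudBoundedStates_zero :
    ¬ LoudBoundedStates (fun _ : UnitAddTorus (Fin 3) => (0 : EuclideanSpace ℝ (Fin 3))) := by
  rintro ⟨ν, E, ε, -, -, hε, h⟩
  obtain ⟨N, U, hU, -, hloud⟩ := (h 0).exists
  have hid := energy_identity hU continuous_const
  simp only [inner_zero_left, integral_zero] at hid
  linarith

/-- **Any proof must use the force.** The force-free weakening of the crux is false (witness `f = 0`). [folklore] -/
theorem taylorGreenLoud_false_without_force : ¬ TaylorGreenLoudGalerkinStatesWithoutForce := fun h =>
  not_loudBoundedStates_zero (h _ (isSmooth_const _) isDivFree_zero (by simp [HasZeroMean]))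

/-! ### (b) The constants: loudness never exceeds the injection ceiling `√E` -/

/-- Pointwise bound `‖f_TG(x)‖ ≤ 1` (`sin²a cos²b + cos²a sin²b ≤ (sin²a + cos²a)(cos²b + sin²b) = 1`, `cos² ≤ 1`). [folklore] -/
theorem norm_tgForce_le (x : UnitAddTorus (Fin 3)) : ‖tgForce x‖ ≤ 1 := by
  have hn : ∀ i : Fin 3, ((fourier 1 (x i) : ℂ)).re ^ 2 + ((fourier 1 (x i) : ℂ)).im ^ 2 = 1 := by
    intro i
    have h1 : ‖(fourier 1 (x i) : ℂ)‖ = 1 := by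
      rw [fourier_apply]
      exact Circle.norm_coe _
    have h2 := Complex.sq_norm (fourier 1 (x i) : ℂ)
    rw [h1, Complex.normSq_apply] at h2
    nlinarith [h2]
  have hsq : ‖tgForce x‖ ^ 2 =
      (((fourier 1 (x 0) : ℂ)).im * ((fourier 1 (x 1) : ℂ)).re * ((fourier 1 (x 2) : ℂ)).re) ^ 2 +
        (((fourier 1 (x 0) : ℂ)).re * ((fourier 1 (x 1) : ℂ)).im * ((fourier 1 (x 2) : ℂ)).re) ^ 2 := by
    rw [EuclideanSpace.real_norm_sq_eq, Fin.sum_univ_three]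
    simp only [tgForce, PiLp.toLp_apply, Matrix.cons_val_zero, Matrix.cons_val_one, Matrix.cons_val_two,
      Matrix.head_cons, Matrix.tail_cons]
    ring
  have hle : (((fourier 1 (x 0) : ℂ)).im * ((fourier 1 (x 1) : ℂ)).re * ((fourier 1 (x 2) : ℂ)).re) ^ 2 +
      (((fourier 1 (x 0) : ℂ)).re * ((fourier 1 (x 1) : ℂ)).im * ((fourier 1 (x 2) : ℂ)).re) ^ 2 ≤ 1 := by
    have h0 := hn 0
    have h1 := hn 1
    have h2 := hn 2
    generalize ((fourier 1 (x 0) : ℂ)).re = r0 at h0 ⊢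
    generalize ((fourier 1 (x 0) : ℂ)).im = s0 at h0 ⊢
    generalize ((fourier 1 (x 1) : ℂ)).re = r1 at h1 ⊢
    generalize ((fourier 1 (x 1) : ℂ)).im = s1 at h1 ⊢
    generalize ((fourier 1 (x 2) : ℂ)).re = r2 at h2 ⊢
    generalize ((fourier 1 (x 2) : ℂ)).im = s2 at h2 ⊢
    have hA : s0 ^ 2 * r1 ^ 2 + r0 ^ 2 * s1 ^ 2 ≤ 1 := by
      have hprod : (r0 ^ 2 + s0 ^ 2) * (r1 ^ 2 + s1 ^ 2) = 1 := by rw [h0, h1, one_mul]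
      nlinarith [sq_nonneg (s0 * s1), sq_nonneg (r0 * r1)]
    have hB : r2 ^ 2 ≤ 1 := by nlinarith [sq_nonneg s2]
    have hA0 : 0 ≤ s0 ^ 2 * r1 ^ 2 + r0 ^ 2 * s1 ^ 2 := by positivity
    calc (s0 * r1 * r2) ^ 2 + (r0 * s1 * r2) ^ 2 = r2 ^ 2 * (s0 ^ 2 * r1 ^ 2 + r0 ^ 2 * s1 ^ 2) := by ring
      _ ≤ 1 * 1 := mul_le_mul hB hA hA0 zero_le_one
      _ = 1 := one_mul 1
  rw [← hsq] at hle
  exact (sq_le_one_iff₀ (norm_nonneg _)).1 hle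

/-- `f_TG` is continuous. [folklore] -/
theorem continuous_tgForce : Continuous tgForce := by
  have hc : ∀ i : Fin 3, Continuous fun x : UnitAddTorus (Fin 3) => (fourier 1 (x i) : ℂ) := fun i =>
    (fourier 1).continuous.comp (continuous_apply i)
  unfold tgForce
  refine (PiLp.continuous_toLp 2 _).comp ?_
  refine continuous_pi fun i => ?_
  fin_cases i
  · exact ((Complex.continuous_im.comp (hc 0)).mul (Complex.continuous_re.comp (hc 1))).mul
      (Complex.continuous_re.comp (hc 2))
  · exact (((Complex.continuous_re.comp (hc 0)).mul (Complex.continuous_im.comp (hc 1))).mul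
      (Complex.continuous_re.comp (hc 2))).neg
  · exact continuous_const

/-- `∫ ‖U‖ ≤ √(∫ ‖U‖²)` on the (probability) torus, for continuous `U` (Jensen / AM–GM with a free parameter). [folklore] -/
theorem integral_norm_le_sqrt {U : UnitAddTorus (Fin 3) → EuclideanSpace ℝ (Fin 3)} (hU : Continuous U) :
    ∫ x, ‖U x‖ ≤ Real.sqrt (∫ x, ‖U x‖ ^ 2) := by
  set I := ∫ x, ‖U x‖ ^ 2 with hI
  have hI0 : 0 ≤ I := integral_nonneg fun _ => sq_nonneg _
  have i1 : Integrable (fun x => ‖U x‖) volume := hU.norm.integrable_unitAddTorus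
  have i2 : Integrable (fun x => ‖U x‖ ^ 2) volume := (hU.norm.pow 2).integrable_unitAddTorus
  -- AM–GM with parameter `t > 0`: `‖U x‖ ≤ t/2 + ‖U x‖²/(2t)`
  have hAMGM : ∀ t : ℝ, 0 < t → ∫ x, ‖U x‖ ≤ t / 2 + I / (2 * t) := by
    intro t ht
    have hpt : ∀ x, ‖U x‖ ≤ t / 2 + ‖U x‖ ^ 2 / (2 * t) := by
      intro x
      have h2t : 0 < 2 * t := by positivity
      rw [div_add_div _ _ two_ne_zero h2t.ne', le_div_iff₀ (by positivity)]
      nlinarith [sq_nonneg (‖U x‖ - t)]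
    calc ∫ x, ‖U x‖ ≤ ∫ x, (t / 2 + ‖U x‖ ^ 2 / (2 * t)) :=
          integral_mono i1 ((integrable_const _).add (i2.div_const _)) hpt
      _ = t / 2 + I / (2 * t) := by
          rw [integral_add (integrable_const _) (i2.div_const _), integral_const, integral_div]
          simp [hI]
  rcases hI0.lt_or_eq with hpos | hzero
  · have ht : 0 < Real.sqrt I := Real.sqrt_pos.2 hpos
    have h := hAMGM (Real.sqrt I) ht
    have hsq : I = Real.sqrt I * Real.sqrt I := (Real.mul_self_sqrt hI0).symm
    calc ∫ x, ‖U x‖ ≤ Real.sqrt I / 2 + I / (2 * Real.sqrt I) := h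
      _ = Real.sqrt I := by
          field_simp
          nlinarith [hsq]
  · -- `I = 0`: the bound `t/2` for every `t > 0`
    rw [← hzero, Real.sqrt_zero]
    refine le_of_forall_pos_le_add fun t ht => ?_
    have h := hAMGM t ht
    rw [← hzero, zero_div, add_zero] at h
    linarith

/-- **Injection ceiling.** For the Taylor–Green force, every admissible state has `ν‖∇U‖² = ∫⟪f_TG, U⟫ ≤ √(∫|U|²)`
(pointwise `‖f_TG‖ ≤ 1` and Jensen; the sharp constant is `‖f_TG‖_{L²} = 1/2`). [folklore] -/
theorem loudness_le_sqrt_energy {ν : ℝ} {N : ℕ} {U : UnitAddTorus (Fin 3) → EuclideanSpace ℝ (Fin 3)}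
    (hU : IsSteadyState ν N tgForce U) : ν * gradNormSq U ≤ Real.sqrt (∫ x, ‖U x‖ ^ 2) := by
  have hs : IsSmooth U := hU.1
  rw [energy_identity hU continuous_tgForce]
  calc ∫ x, ⟪tgForce x, U x⟫_ℝ ≤ ∫ x, ‖U x‖ := by
        refine integral_mono (continuous_tgForce.inner hs.continuous).integrable_unitAddTorus
          hs.continuous.norm.integrable_unitAddTorus fun x => ?_
        calc ⟪tgForce x, U x⟫_ℝ ≤ ‖tgForce x‖ * ‖U x‖ := real_inner_le_norm _ _
          _ ≤ 1 * ‖U x‖ := mul_le_mul_of_nonneg_right (norm_tgForce_le x) (norm_nonneg _)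
          _ = ‖U x‖ := one_mul _
    _ ≤ Real.sqrt (∫ x, ‖U x‖ ^ 2) := integral_norm_le_sqrt hs.continuous

/-- **Constants window (natural strengthening refuted).** The crux with the extra clause `E < ε²` is FALSE for the
Taylor–Green force: `ε ≤ ν_j‖∇U‖² ≤ √(∫|U|²) ≤ √E < ε`. So any witness has `ε² ≤ E` (indeed `4ε² ≤ E`). [folklore] -/
theorem not_loud_of_energy_lt_sq :
    ¬ ∃ (ν : ℕ → ℝ) (E ε : ℝ), (∀ j, 0 < ν j) ∧ Tendsto ν atTop (𝓝 0) ∧ 0 < ε ∧ E < ε ^ 2 ∧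
        LoudAlong tgForce ν E ε := by
  rintro ⟨ν, E, ε, -, -, hε, hE, h⟩
  obtain ⟨N, U, hU, hUE, hloud⟩ := (h 0).exists
  have h1 := loudness_le_sqrt_energy hU
  have h2 : Real.sqrt (∫ x, ‖U x‖ ^ 2) ≤ Real.sqrt E := Real.sqrt_le_sqrt hUE
  have h3 : Real.sqrt E < ε := (Real.sqrt_lt' hε).2 hE
  linarith

/-! ### (b♯) The sharp injection ceiling: `f_TG` lives on the shell `|k|² = 3`

`f_TG` is written as an explicit real trigonometric polynomial on the 8 wavevectors `(±1,±1,±1)` with coefficients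
`f̂(k) = (i/8)(−k₀, k₁, 0)`; hence it is smooth, divergence free, mean zero (the regularity half of the line's
`stub_tgForceRegular`, recorded here because the anatomy needs the Fourier support), `‖f_TG‖²_{L²} = 1/4`, and the
injection is carried by the TG shell: `∫⟪f_TG, U⟫ = Σ_{shell} Re⟪f̂(k), Û(k)⟫ ≤ ½ (Σ_{shell} ‖Û(k)‖²)^{1/2}`. -/

/-- The Taylor–Green shell: the 8 wavevectors `(±1, ±1, ±1)` (`|k|² = 3`). -/
def tgShell : Finset (Fin 3 → ℤ) := Fintype.piFinset fun _ : Fin 3 => ({1, -1} : Finset ℤ)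

/-- The Fourier coefficients of `f_TG`: `f̂(k) = (i/8)(−k₀, k₁, 0)` (used on the TG shell). -/
def tgCoeff (k : Fin 3 → ℤ) : EuclideanSpace ℂ (Fin 3) :=
  ((8⁻¹ : ℝ) : ℂ) • !₂[-(Complex.I * (k 0 : ℂ)), Complex.I * (k 1 : ℂ), 0]

/-- `1 ≠ -1` in `ℤ`. [folklore] -/
theorem one_ne_neg_one_int : (1 : ℤ) ≠ -1 := by decide

/-- The sum over the TG shell of a product `∏ⱼ g j (k j)` factorises. -/
theorem sum_tgShell_prod (g : Fin 3 → ℤ → ℂ) :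
    ∑ k ∈ tgShell, ∏ j, g j (k j) = ∏ j, (g j 1 + g j (-1)) := by
  rw [tgShell, ← Finset.prod_univ_sum]
  refine Finset.prod_congr rfl fun j _ => ?_
  rw [Finset.sum_pair one_ne_neg_one_int]

/-- The Fourier character on `T³` factors over the three coordinates. [folklore] -/
theorem mFourier_three (k : Fin 3 → ℤ) (x : UnitAddTorus (Fin 3)) :
    UnitAddTorus.mFourier k x = fourier (k 0) (x 0) * fourier (k 1) (x 1) * fourier (k 2) (x 2) := by
  simp [UnitAddTorus.mFourier, Fin.prod_univ_three]

/-- First component of `f_TG` as the shell sum: `Re Σ_{shell} e_k(x) f̂(k)₀ = sin2πx₀ cos2πx₁ cos2πx₂`. [folklore] -/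
theorem tgForce_apply_zero (x : UnitAddTorus (Fin 3)) :
    (∑ k ∈ tgShell, UnitAddTorus.mFourier k x * tgCoeff k 0).re = tgForce x 0 := by
  have h : ∀ k ∈ tgShell, UnitAddTorus.mFourier k x * tgCoeff k 0 =
      ∏ j, (![fun a : ℤ => fourier a (x 0) * (((8⁻¹ : ℝ) : ℂ) * -(Complex.I * (a : ℂ))),
        fun a : ℤ => (fourier a (x 1) : ℂ), fun a : ℤ => (fourier a (x 2) : ℂ)] : Fin 3 → ℤ → ℂ) j (k j) := by
    intro k _
    rw [mFourier_three, Fin.prod_univ_three]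
    simp [tgCoeff]
    ring
  rw [Finset.sum_congr rfl h, sum_tgShell_prod, Fin.prod_univ_three]
  simp only [Matrix.cons_val_zero, Matrix.cons_val_one, Matrix.cons_val_two, Matrix.head_cons, Matrix.tail_cons,
    fourier_neg, Int.cast_one, Int.cast_neg, tgForce, PiLp.toLp_apply]
  simp only [Complex.mul_re, Complex.mul_im, Complex.add_re, Complex.add_im, Complex.neg_re, Complex.neg_im,
    Complex.conj_re, Complex.conj_im, Complex.I_re, Complex.I_im, Complex.ofReal_re, Complex.ofReal_im,
    Complex.one_re, Complex.one_im, zero_mul, sub_zero, zero_sub, add_zero, zero_add, mul_one, one_mul]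
  ring

/-- Second component of `f_TG` as the shell sum: `Re Σ_{shell} e_k(x) f̂(k)₁ = −cos2πx₀ sin2πx₁ cos2πx₂`. [folklore] -/
theorem tgForce_apply_one (x : UnitAddTorus (Fin 3)) :
    (∑ k ∈ tgShell, UnitAddTorus.mFourier k x * tgCoeff k 1).re = tgForce x 1 := by
  have h : ∀ k ∈ tgShell, UnitAddTorus.mFourier k x * tgCoeff k 1 =
      ∏ j, (![fun a : ℤ => (fourier a (x 0) : ℂ),
        fun a : ℤ => fourier a (x 1) * (((8⁻¹ : ℝ) : ℂ) * (Complex.I * (a : ℂ))),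
        fun a : ℤ => (fourier a (x 2) : ℂ)] : Fin 3 → ℤ → ℂ) j (k j) := by
    intro k _
    rw [mFourier_three, Fin.prod_univ_three]
    simp [tgCoeff]
    ring
  rw [Finset.sum_congr rfl h, sum_tgShell_prod, Fin.prod_univ_three]
  simp only [Matrix.cons_val_zero, Matrix.cons_val_one, Matrix.cons_val_two, Matrix.head_cons, Matrix.tail_cons,
    fourier_neg, Int.cast_one, Int.cast_neg, tgForce, PiLp.toLp_apply]
  simp only [Complex.mul_re, Complex.mul_im, Complex.add_re, Complex.add_im, Complex.neg_re, Complex.neg_im,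
    Complex.conj_re, Complex.conj_im, Complex.I_re, Complex.I_im, Complex.ofReal_re, Complex.ofReal_im,
    Complex.one_re, Complex.one_im, zero_mul, sub_zero, zero_sub, add_zero, zero_add, mul_one, one_mul]
  ring

/-- Third component of `f_TG` vanishes, as does the shell sum of `f̂(k)₂ = 0`. [folklore] -/
theorem tgForce_apply_two (x : UnitAddTorus (Fin 3)) :
    (∑ k ∈ tgShell, UnitAddTorus.mFourier k x * tgCoeff k 2).re = tgForce x 2 := by
  simp [tgCoeff, tgForce]

/-- **`f_TG` is a real trigonometric polynomial on the Taylor–Green shell** with coefficients `tgCoeff`. -/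
theorem tgForce_eq_realTrigPoly : tgForce = realTrigPoly tgShell tgCoeff := by
  funext x
  ext i
  rw [realTrigPoly_apply_coord, trigPoly_apply_coord]
  fin_cases i
  · exact (tgForce_apply_zero x).symm
  · exact (tgForce_apply_one x).symm
  · exact (tgForce_apply_two x).symm

/-- The TG shell is symmetric under `k ↦ -k`. [folklore] -/
theorem neg_mem_tgShell : ∀ k ∈ tgShell, -k ∈ tgShell := by
  intro k hk
  rw [tgShell, Fintype.mem_piFinset] at hk ⊢
  intro j
  have hj := hk j
  simp only [Finset.mem_insert, Finset.mem_singleton, Pi.neg_apply] at hj ⊢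
  rcases hj with h | h <;> simp [h]

/-- The mean mode is not on the TG shell. [folklore] -/
theorem zero_not_mem_tgShell : (0 : Fin 3 → ℤ) ∉ tgShell := by
  rw [tgShell, Fintype.mem_piFinset]
  intro h
  have := h 0
  simp at this

/-- Coordinates of shell vectors square to one. [folklore] -/
theorem sq_eq_one_of_mem_tgShell {k : Fin 3 → ℤ} (hk : k ∈ tgShell) (j : Fin 3) : (k j : ℂ) ^ 2 = 1 := by
  rw [tgShell, Fintype.mem_piFinset] at hk
  have hj := hk j
  simp only [Finset.mem_insert, Finset.mem_singleton] at hj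
  rcases hj with h | h <;> simp [h]

/-- The TG coefficients satisfy the reality condition `f̂(−k) = conj f̂(k)`. [folklore] -/
theorem isConjSymm_tgCoeff : IsConjSymm tgCoeff := by
  intro k
  unfold tgCoeff
  ext i
  fin_cases i <;>
    simp [EuclideanSpace.conjVec_apply, Complex.ext_iff]

/-- The TG coefficients are transversal on the shell: `k · f̂(k) = (i/8)(k₁² − k₀²) = 0`. [folklore] -/
theorem isTransversal_tgCoeff : IsTransversal tgShell tgCoeff := by
  intro k hk
  have h0 := sq_eq_one_of_mem_tgShell hk 0
  have h1 := sq_eq_one_of_mem_tgShell hk 1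
  simp only [tgCoeff, Fin.sum_univ_three, PiLp.smul_apply, smul_eq_mul, Matrix.cons_val_zero,
    Matrix.cons_val_one, Matrix.cons_val_two, Matrix.head_cons, Matrix.tail_cons]
  linear_combination (((8⁻¹ : ℝ) : ℂ) * Complex.I) * (h1 - h0)

/-- `f_TG` is smooth (a trigonometric polynomial). [folklore] -/
theorem isSmooth_tgForce : IsSmooth tgForce := by
  rw [tgForce_eq_realTrigPoly]; exact isSmooth_realTrigPoly _ _

/-- `f_TG` is divergence free. [folklore] -/
theorem isDivFree_tgForce : IsDivFree tgForce := by
  rw [tgForce_eq_realTrigPoly]; exact isDivFree_realTrigPoly isTransversal_tgCoeff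

/-- `f_TG` has zero mean. [folklore] -/
theorem hasZeroMean_tgForce : HasZeroMean tgForce := by
  rw [tgForce_eq_realTrigPoly]; exact Literature.Analysis.FluidPDE.hasZeroMean_realTrigPoly_of_zero_not_mem zero_not_mem_tgShell _

/-- The Fourier coefficients of `f_TG`: `tgCoeff` on the TG shell, `0` elsewhere. -/
theorem mFourierCoeff_tgForce (k : Fin 3 → ℤ) :
    UnitAddTorus.mFourierCoeff (EuclideanSpace.complexify ∘ tgForce) k = if k ∈ tgShell then tgCoeff k else 0 := by
  rw [tgForce_eq_realTrigPoly]; exact mFourierCoeff_realTrigPoly neg_mem_tgShell isConjSymm_tgCoeff k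

/-- `‖f̂(k)‖² = 1/32` on the shell. [folklore] -/
theorem norm_sq_tgCoeff {k : Fin 3 → ℤ} (hk : k ∈ tgShell) : ‖tgCoeff k‖ ^ 2 = 32⁻¹ := by
  rw [tgShell, Fintype.mem_piFinset] at hk
  have h0 := hk 0
  have h1 := hk 1
  simp only [Finset.mem_insert, Finset.mem_singleton] at h0 h1
  rw [EuclideanSpace.norm_sq_eq, Fin.sum_univ_three]
  simp only [tgCoeff, PiLp.smul_apply, smul_eq_mul, Matrix.cons_val_zero,
    Matrix.cons_val_one, Matrix.cons_val_two, Matrix.head_cons, Matrix.tail_cons, norm_mul, norm_neg,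
    Complex.norm_I, Complex.norm_real, Complex.norm_intCast, mul_zero, norm_zero]
  rcases h0 with h0 | h0 <;> rcases h1 with h1 | h1 <;> simp [h0, h1] <;> norm_num

/-- The TG shell has 8 points. [folklore] -/
theorem card_tgShell : tgShell.card = 8 := by
  rw [tgShell, Fintype.card_piFinset]
  simp [Finset.card_pair one_ne_neg_one_int]

/-- `‖f_TG‖²_{L²} = ∑_{k ∈ shell} ‖f̂(k)‖² = 8 · 1/32 = 1/4`. -/
theorem sum_norm_sq_tgCoeff : ∑ k ∈ tgShell, ‖tgCoeff k‖ ^ 2 = 4⁻¹ := by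
  rw [Finset.sum_congr rfl fun k hk => norm_sq_tgCoeff hk, Finset.sum_const, card_tgShell]
  norm_num

/-- `∫ ‖f_TG‖² = 1/4` (finite Parseval). [folklore] -/
theorem integral_norm_sq_tgForce : ∫ x, ‖tgForce x‖ ^ 2 = 4⁻¹ := by
  rw [tgForce_eq_realTrigPoly, integral_norm_sq_realTrigPoly neg_mem_tgShell isConjSymm_tgCoeff, sum_norm_sq_tgCoeff]

/-- **Injection is carried by the TG shell**: `∫⟪f_TG, U⟫ = Σ_{k ∈ shell} Re⟪f̂(k), Û(k)⟫` for `U ∈ L²`. -/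
theorem integral_inner_tgForce_eq_sum {U : UnitAddTorus (Fin 3) → EuclideanSpace ℝ (Fin 3)} (hU : MemLp U 2 volume) :
    ∫ x, ⟪tgForce x, U x⟫_ℝ =
      ∑ k ∈ tgShell, (inner ℂ (tgCoeff k) (UnitAddTorus.mFourierCoeff (EuclideanSpace.complexify ∘ U) k)).re := by
  conv_lhs => rw [tgForce_eq_realTrigPoly]
  exact integral_inner_realTrigPoly_left neg_mem_tgShell isConjSymm_tgCoeff hU

/-- **Shell Cauchy–Schwarz**: `∫⟪f_TG, U⟫ ≤ ½ (Σ_{k ∈ shell} ‖Û(k)‖²)^{1/2}`. -/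
theorem integral_inner_tgForce_le_shell {U : UnitAddTorus (Fin 3) → EuclideanSpace ℝ (Fin 3)} (hU : MemLp U 2 volume) :
    ∫ x, ⟪tgForce x, U x⟫_ℝ ≤
      2⁻¹ * Real.sqrt (∑ k ∈ tgShell, ‖UnitAddTorus.mFourierCoeff (EuclideanSpace.complexify ∘ U) k‖ ^ 2) := by
  rw [integral_inner_tgForce_eq_sum hU]
  set b : (Fin 3 → ℤ) → ℝ := fun k => ‖UnitAddTorus.mFourierCoeff (EuclideanSpace.complexify ∘ U) k‖ with hb
  have h1 : ∑ k ∈ tgShell, (inner ℂ (tgCoeff k) (UnitAddTorus.mFourierCoeff (EuclideanSpace.complexify ∘ U) k)).re ≤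
      ∑ k ∈ tgShell, ‖tgCoeff k‖ * b k := by
    refine Finset.sum_le_sum fun k _ => ?_
    exact (Complex.re_le_norm _).trans (norm_inner_le_norm _ _)
  have h2 : (∑ k ∈ tgShell, ‖tgCoeff k‖ * b k) ^ 2 ≤ (∑ k ∈ tgShell, ‖tgCoeff k‖ ^ 2) * ∑ k ∈ tgShell, b k ^ 2 :=
    Finset.sum_mul_sq_le_sq_mul_sq _ _ _
  rw [sum_norm_sq_tgCoeff] at h2
  have hB : 0 ≤ ∑ k ∈ tgShell, b k ^ 2 := Finset.sum_nonneg fun _ _ => sq_nonneg _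
  have h3 : ∑ k ∈ tgShell, ‖tgCoeff k‖ * b k ≤ Real.sqrt (4⁻¹ * ∑ k ∈ tgShell, b k ^ 2) :=
    (le_abs_self _).trans (Real.abs_le_sqrt h2)
  have h4 : Real.sqrt (4⁻¹ * ∑ k ∈ tgShell, b k ^ 2) = 2⁻¹ * Real.sqrt (∑ k ∈ tgShell, b k ^ 2) := by
    rw [Real.sqrt_mul (by norm_num : (0 : ℝ) ≤ 4⁻¹), Real.sqrt_inv, show (4 : ℝ) = 2 ^ 2 by norm_num,
      Real.sqrt_sq (by norm_num : (0 : ℝ) ≤ 2)]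
  exact h1.trans (h3.trans_eq h4)


/-- Bessel on the TG shell: `Σ_{k ∈ shell} ‖Û(k)‖² ≤ ∫ |U|²` for `U ∈ L²`. [folklore] -/
theorem shellEnergy_le_energy {U : UnitAddTorus (Fin 3) → EuclideanSpace ℝ (Fin 3)} (hU : MemLp U 2 volume) :
    ∑ k ∈ tgShell, ‖UnitAddTorus.mFourierCoeff (EuclideanSpace.complexify ∘ U) k‖ ^ 2 ≤ ∫ x, ‖U x‖ ^ 2 :=
  sum_le_hasSum tgShell (fun _ _ => sq_nonneg _) (hasSum_sq_norm_mFourierCoeff_complexify hU)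

/-- **Sharp injection ceiling through the forcing shell.** For an admissible state of the Taylor–Green force,
`ν‖∇U‖² = ∫⟪f_TG, U⟫ ≤ ½ (Σ_{k ∈ shell} ‖Û(k)‖²)^{1/2}`. [folklore] -/
theorem loudness_le_half_sqrt_shellEnergy {ν : ℝ} {N : ℕ} {U : UnitAddTorus (Fin 3) → EuclideanSpace ℝ (Fin 3)}
    (hU : IsSteadyState ν N tgForce U) :
    ν * gradNormSq U ≤
      2⁻¹ * Real.sqrt (∑ k ∈ tgShell, ‖UnitAddTorus.mFourierCoeff (EuclideanSpace.complexify ∘ U) k‖ ^ 2) := by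
  rw [energy_identity hU continuous_tgForce]
  exact integral_inner_tgForce_le_shell
    (hU.1.continuous.memLp_of_hasCompactSupport (HasCompactSupport.of_compactSpace _))

/-- **Sharp constants window**: `ν‖∇U‖² ≤ ½ √(∫|U|²)` (Cauchy–Schwarz with `‖f_TG‖_{L²} = ½`), so every witness of
the crux has `4ε² ≤ E`. [folklore] -/
theorem loudness_le_half_sqrt_energy {ν : ℝ} {N : ℕ} {U : UnitAddTorus (Fin 3) → EuclideanSpace ℝ (Fin 3)}
    (hU : IsSteadyState ν N tgForce U) : ν * gradNormSq U ≤ 2⁻¹ * Real.sqrt (∫ x, ‖U x‖ ^ 2) := by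
  refine (loudness_le_half_sqrt_shellEnergy hU).trans ?_
  have hmem : MemLp U 2 volume :=
    hU.1.continuous.memLp_of_hasCompactSupport (HasCompactSupport.of_compactSpace _)
  exact mul_le_mul_of_nonneg_left (Real.sqrt_le_sqrt (shellEnergy_le_energy hmem)) (by norm_num)

/-- **Natural strengthening refuted (sharp form): `E < 4ε²`.** [folklore] -/
theorem not_loud_of_energy_lt_four_sq :
    ¬ ∃ (ν : ℕ → ℝ) (E ε : ℝ), (∀ j, 0 < ν j) ∧ Tendsto ν atTop (𝓝 0) ∧ 0 < ε ∧ E < 4 * ε ^ 2 ∧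
        LoudAlong tgForce ν E ε := by
  rintro ⟨ν, E, ε, -, -, hε, hE, h⟩
  obtain ⟨N, U, hU, hUE, hloud⟩ := (h 0).exists
  have h1 := loudness_le_half_sqrt_energy hU
  have h2 : Real.sqrt (∫ x, ‖U x‖ ^ 2) ≤ Real.sqrt E := Real.sqrt_le_sqrt hUE
  have h3 : Real.sqrt E < 2 * ε := by
    rw [Real.sqrt_lt' (by positivity)]
    nlinarith
  nlinarith

/-- **Forcing-shell amplitude floor (anatomy of a witness).** A loud admissible state of the Taylor–Green force keeps
energy `≥ 4ε²` on the forcing shell `|k|² = 3` — while (`high_mode_dissipation_floor`) its enstrophy escapes to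
`|k| → ∞`: the two ends of a cascade, both forced by the statement itself. [folklore] -/
theorem shell_energy_floor {ν ε : ℝ} {N : ℕ} {U : UnitAddTorus (Fin 3) → EuclideanSpace ℝ (Fin 3)}
    (hU : IsSteadyState ν N tgForce U) (hε : 0 ≤ ε) (hloud : ε ≤ ν * gradNormSq U) :
    4 * ε ^ 2 ≤ ∑ k ∈ tgShell, ‖UnitAddTorus.mFourierCoeff (EuclideanSpace.complexify ∘ U) k‖ ^ 2 := by
  set S := ∑ k ∈ tgShell, ‖UnitAddTorus.mFourierCoeff (EuclideanSpace.complexify ∘ U) k‖ ^ 2 with hS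
  have hS0 : 0 ≤ S := Finset.sum_nonneg fun _ _ => sq_nonneg _
  have h1 : ε ≤ 2⁻¹ * Real.sqrt S := hloud.trans (loudness_le_half_sqrt_shellEnergy hU)
  have h2 : 2 * ε ≤ Real.sqrt S := by linarith
  have h3 : (2 * ε) ^ 2 ≤ Real.sqrt S ^ 2 := pow_le_pow_left₀ (by linarith) h2 2
  rw [Real.sq_sqrt hS0] at h3
  linarith

/-! ### (c) The resolution: bounded states are quiet at fixed `N` (Bernstein) -/

/-- **Bernstein inequality for Galerkin fields.** A smooth field band-limited to `|k|² ≤ N²` has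
`‖∇U‖² ≤ 4π² N² ∫|U|²` (Parseval: `‖∇U‖² = 4π² Σ_{|k|≤N} |k|²‖Û_k‖² ≤ 4π²N² Σ ‖Û_k‖²`). [folklore] -/
theorem gradNormSq_le_of_isBandLimited {U : UnitAddTorus (Fin 3) → EuclideanSpace ℝ (Fin 3)} (hU : IsSmooth U)
    {N : ℕ} (hband : IsBandLimited N U) :
    gradNormSq U ≤ 4 * Real.pi ^ 2 * (N : ℝ) ^ 2 * ∫ x, ‖U x‖ ^ 2 := by
  have hband' : ∀ k : Fin 3 → ℤ, (N : ℝ) ^ 2 < freqNormSq k →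
      UnitAddTorus.mFourierCoeff (EuclideanSpace.complexify ∘ U) k = 0 := fun k hk =>
    hband k fun hmem => (not_mem_freqBall.2 hk) (Finset.mem_of_mem_erase hmem)
  have hnn : 0 ≤ 4 * Real.pi ^ 2 * ∑ k ∈ freqBall N,
      freqNormSq k * ‖UnitAddTorus.mFourierCoeff (EuclideanSpace.complexify ∘ U) k‖ ^ 2 :=
    mul_nonneg (by positivity) (Finset.sum_nonneg fun k _ =>
      mul_nonneg (Finset.sum_nonneg fun i _ => sq_nonneg _) (sq_nonneg _))
  rw [gradNormSq_eq_toReal_eGradNormSq_holds hU, eGradNormSq_eq_sum_of_band_limited hU.continuous hband',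
    integral_norm_sq_eq_sum_of_band_limited hU.continuous hband',
    ENNReal.toReal_ofReal hnn, Finset.mul_sum, Finset.mul_sum]
  refine Finset.sum_le_sum fun k hk => ?_
  have hk' : freqNormSq k ≤ (N : ℝ) ^ 2 := mem_freqBall.1 hk
  have h0 : 0 ≤ ‖UnitAddTorus.mFourierCoeff (EuclideanSpace.complexify ∘ U) k‖ ^ 2 := sq_nonneg _
  calc 4 * Real.pi ^ 2 * (freqNormSq k * ‖UnitAddTorus.mFourierCoeff (EuclideanSpace.complexify ∘ U) k‖ ^ 2)
      ≤ 4 * Real.pi ^ 2 * ((N : ℝ) ^ 2 * ‖UnitAddTorus.mFourierCoeff (EuclideanSpace.complexify ∘ U) k‖ ^ 2) := by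
        gcongr
    _ = 4 * Real.pi ^ 2 * (N : ℝ) ^ 2 * ‖UnitAddTorus.mFourierCoeff (EuclideanSpace.complexify ∘ U) k‖ ^ 2 := by
        ring

/-- **Resolution floor.** A loud bounded admissible state at `(ν, N)` (any force) forces `ε ≤ 4π² ν N² E`, i.e.
`N ≥ (ε / 4π²νE)^{1/2}`: loudness at bounded energy is an `N → ∞` phenomenon along `ν_j → 0`. [folklore] -/
theorem resolution_floor {ν E ε : ℝ} {N : ℕ} {f U : UnitAddTorus (Fin 3) → EuclideanSpace ℝ (Fin 3)}
    (hν : 0 ≤ ν) (hU : IsSteadyState ν N f U) (hE : ∫ x, ‖U x‖ ^ 2 ≤ E) (hloud : ε ≤ ν * gradNormSq U) :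
    ε ≤ 4 * Real.pi ^ 2 * ν * (N : ℝ) ^ 2 * E := by
  have hB := gradNormSq_le_of_isBandLimited hU.1 hU.2.2.2.1
  calc ε ≤ ν * gradNormSq U := hloud
    _ ≤ ν * (4 * Real.pi ^ 2 * (N : ℝ) ^ 2 * ∫ x, ‖U x‖ ^ 2) := mul_le_mul_of_nonneg_left hB hν
    _ ≤ ν * (4 * Real.pi ^ 2 * (N : ℝ) ^ 2 * E) := by gcongr
    _ = 4 * Real.pi ^ 2 * ν * (N : ℝ) ^ 2 * E := by ring

/-- **Natural strengthening refuted: one resolution for all `j`.** For EVERY force `f`: there is no fixed resolution `N`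
carrying loud bounded admissible states along a sequence `ν_j → 0⁺` (`ε ≤ 4π²ν_jN²E → 0`). [folklore] -/
theorem not_loud_at_fixed_resolution (f : UnitAddTorus (Fin 3) → EuclideanSpace ℝ (Fin 3)) :
    ¬ ∃ (ν : ℕ → ℝ) (E ε : ℝ) (N : ℕ), (∀ j, 0 < ν j) ∧ Tendsto ν atTop (𝓝 0) ∧ 0 < ε ∧
        ∀ j, ∃ U : UnitAddTorus (Fin 3) → EuclideanSpace ℝ (Fin 3),
          IsSteadyState (ν j) N f U ∧ ∫ x, ‖U x‖ ^ 2 ≤ E ∧ ε ≤ ν j * gradNormSq U := by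
  rintro ⟨ν, E, ε, N, hν, hlim, hε, h⟩
  have hbound : ∀ j, ε ≤ 4 * Real.pi ^ 2 * ν j * (N : ℝ) ^ 2 * E := fun j => by
    obtain ⟨U, hU, hE, hloud⟩ := h j
    exact resolution_floor (hν j).le hU hE hloud
  have hT : Tendsto (fun j => 4 * Real.pi ^ 2 * ν j * (N : ℝ) ^ 2 * E) atTop (𝓝 (4 * Real.pi ^ 2 * 0 * (N : ℝ) ^ 2 * E)) :=
    ((tendsto_const_nhds.mul hlim).mul tendsto_const_nhds).mul tendsto_const_nhds
  rw [mul_zero, zero_mul, zero_mul] at hT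
  have : ε ≤ 0 := ge_of_tendsto' hT hbound
  linarith

/-- **Natural strengthening refuted: the quantifier swap.** For EVERY force `f`, the crux's `∀ j, ∀ᶠ N` cannot be
strengthened to `∀ᶠ N, ∀ j` (a `j`-uniform resolution threshold): false by the resolution floor. [folklore] -/
theorem not_loud_uniformly_in_resolution (f : UnitAddTorus (Fin 3) → EuclideanSpace ℝ (Fin 3)) :
    ¬ ∃ (ν : ℕ → ℝ) (E ε : ℝ), (∀ j, 0 < ν j) ∧ Tendsto ν atTop (𝓝 0) ∧ 0 < ε ∧
        ∀ᶠ N in atTop, ∀ j, ∃ U : UnitAddTorus (Fin 3) → EuclideanSpace ℝ (Fin 3),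
          IsSteadyState (ν j) N f U ∧ ∫ x, ‖U x‖ ^ 2 ≤ E ∧ ε ≤ ν j * gradNormSq U := by
  rintro ⟨ν, E, ε, hν, hlim, hε, h⟩
  obtain ⟨N, hN⟩ := h.exists
  exact not_loud_at_fixed_resolution f ⟨ν, E, ε, N, hν, hlim, hε, hN⟩

/-! ### (c') Anatomy: the dissipation of a loud bounded state sits at high wavenumbers -/

/-- The spectral enstrophy of `U` carried by the modes `K² < |k|² ≤ N²` (times `4π²`):
`4π² Σ_{k ∈ freqBall N, K² < |k|²} |k|² ‖Û k‖²`. -/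
def highEnstrophy (K : ℝ) (N : ℕ) (U : UnitAddTorus (Fin 3) → EuclideanSpace ℝ (Fin 3)) : ℝ :=
  4 * Real.pi ^ 2 * ∑ k ∈ (freqBall N).filter (fun k => K ^ 2 < freqNormSq k),
    freqNormSq k * ‖UnitAddTorus.mFourierCoeff (EuclideanSpace.complexify ∘ U) k‖ ^ 2

/-- `highEnstrophy` is nonnegative. [folklore] -/
theorem highEnstrophy_nonneg (K : ℝ) (N : ℕ) (U : UnitAddTorus (Fin 3) → EuclideanSpace ℝ (Fin 3)) :
    0 ≤ highEnstrophy K N U :=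
  mul_nonneg (by positivity) (Finset.sum_nonneg fun k _ =>
    mul_nonneg (Finset.sum_nonneg fun i _ => sq_nonneg _) (sq_nonneg _))

/-- **Low/high splitting of the enstrophy (Bernstein on the low modes).** For a smooth field band-limited to
`|k|² ≤ N²` and any cutoff `K`: `‖∇U‖² ≤ 4π²K² ∫|U|² + highEnstrophy K N U`. [folklore] -/
theorem gradNormSq_le_low_add_high {U : UnitAddTorus (Fin 3) → EuclideanSpace ℝ (Fin 3)} (hU : IsSmooth U)
    {N : ℕ} (hband : IsBandLimited N U) (K : ℝ) :
    gradNormSq U ≤ 4 * Real.pi ^ 2 * K ^ 2 * (∫ x, ‖U x‖ ^ 2) + highEnstrophy K N U := by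
  have hband' : ∀ k : Fin 3 → ℤ, (N : ℝ) ^ 2 < freqNormSq k →
      UnitAddTorus.mFourierCoeff (EuclideanSpace.complexify ∘ U) k = 0 := fun k hk =>
    hband k fun hmem => (not_mem_freqBall.2 hk) (Finset.mem_of_mem_erase hmem)
  set w : (Fin 3 → ℤ) → ℝ := fun k =>
    freqNormSq k * ‖UnitAddTorus.mFourierCoeff (EuclideanSpace.complexify ∘ U) k‖ ^ 2 with hw
  set e : (Fin 3 → ℤ) → ℝ := fun k =>
    ‖UnitAddTorus.mFourierCoeff (EuclideanSpace.complexify ∘ U) k‖ ^ 2 with he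
  have hnn : 0 ≤ 4 * Real.pi ^ 2 * ∑ k ∈ freqBall N, w k :=
    mul_nonneg (by positivity) (Finset.sum_nonneg fun k _ =>
      mul_nonneg (Finset.sum_nonneg fun i _ => sq_nonneg _) (sq_nonneg _))
  have hgrad : gradNormSq U = 4 * Real.pi ^ 2 * ∑ k ∈ freqBall N, w k := by
    rw [gradNormSq_eq_toReal_eGradNormSq_holds hU, eGradNormSq_eq_sum_of_band_limited hU.continuous hband',
      ENNReal.toReal_ofReal hnn]
  have henergy : ∫ x, ‖U x‖ ^ 2 = ∑ k ∈ freqBall N, e k :=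
    integral_norm_sq_eq_sum_of_band_limited hU.continuous hband'
  have hsplit := Finset.sum_filter_add_sum_filter_not (freqBall N) (fun k => K ^ 2 < freqNormSq k) w
  -- the low modes: `|k|² ≤ K²`
  have hlow : ∑ k ∈ (freqBall N).filter (fun k => ¬ K ^ 2 < freqNormSq k), w k ≤ K ^ 2 * ∑ k ∈ freqBall N, e k := by
    calc ∑ k ∈ (freqBall N).filter (fun k => ¬ K ^ 2 < freqNormSq k), w k
        ≤ ∑ k ∈ (freqBall N).filter (fun k => ¬ K ^ 2 < freqNormSq k), K ^ 2 * e k := by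
          refine Finset.sum_le_sum fun k hk => ?_
          have hk' : freqNormSq k ≤ K ^ 2 := not_lt.1 (Finset.mem_filter.1 hk).2
          exact mul_le_mul_of_nonneg_right hk' (sq_nonneg _)
      _ = K ^ 2 * ∑ k ∈ (freqBall N).filter (fun k => ¬ K ^ 2 < freqNormSq k), e k := by rw [Finset.mul_sum]
      _ ≤ K ^ 2 * ∑ k ∈ freqBall N, e k := by
          refine mul_le_mul_of_nonneg_left ?_ (sq_nonneg _)
          exact Finset.sum_le_sum_of_subset_of_nonneg (Finset.filter_subset _ _) fun k _ _ => sq_nonneg _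
  rw [hgrad, henergy, highEnstrophy, ← hsplit]
  have hpi : 0 ≤ 4 * Real.pi ^ 2 := by positivity
  nlinarith [mul_le_mul_of_nonneg_left hlow hpi]

/-- **High-mode dissipation floor (anatomy of a witness).** A loud bounded admissible state at `(ν, N)` (any force)
dissipates at least `ε − 4π²νK²E` in the modes `|k| > K`, for every cutoff `K`: with `K² = ε/(8π²νE)` at least half of
the dissipation sits at wavenumbers `|k| > (ε/8π²νE)^{1/2} → ∞` as `ν → 0`. [folklore] -/
theorem high_mode_dissipation_floor {ν E ε : ℝ} {N : ℕ} {f U : UnitAddTorus (Fin 3) → EuclideanSpace ℝ (Fin 3)}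
    (hν : 0 ≤ ν) (hU : IsSteadyState ν N f U) (hE : ∫ x, ‖U x‖ ^ 2 ≤ E) (hloud : ε ≤ ν * gradNormSq U) (K : ℝ) :
    ε - 4 * Real.pi ^ 2 * ν * K ^ 2 * E ≤ ν * highEnstrophy K N U := by
  have h := gradNormSq_le_low_add_high hU.1 hU.2.2.2.1 K
  have h1 : ν * gradNormSq U ≤ ν * (4 * Real.pi ^ 2 * K ^ 2 * (∫ x, ‖U x‖ ^ 2) + highEnstrophy K N U) :=
    mul_le_mul_of_nonneg_left h hν
  have h2 : ν * (4 * Real.pi ^ 2 * K ^ 2 * ∫ x, ‖U x‖ ^ 2) ≤ ν * (4 * Real.pi ^ 2 * K ^ 2 * E) := by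
    refine mul_le_mul_of_nonneg_left ?_ hν
    exact mul_le_mul_of_nonneg_left hE (by positivity)
  nlinarith [h1, h2]

/-! ### (d) The witness must depend on `j` -/

/-- A single field cannot be loud along `ν_j → 0` (`ν_j‖∇U‖² → 0`). Trivial; recorded for completeness. [folklore] -/
theorem not_loud_with_one_state :
    ¬ ∃ (ν : ℕ → ℝ) (ε : ℝ) (U : UnitAddTorus (Fin 3) → EuclideanSpace ℝ (Fin 3)),
        Tendsto ν atTop (𝓝 0) ∧ 0 < ε ∧ ∀ j, ε ≤ ν j * gradNormSq U := by
  rintro ⟨ν, ε, U, hlim, hε, h⟩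
  have hT : Tendsto (fun j => ν j * gradNormSq U) atTop (𝓝 (0 * gradNormSq U)) := hlim.mul tendsto_const_nhds
  rw [zero_mul] at hT
  have : ε ≤ 0 := ge_of_tendsto' hT h
  linarith

/-! ## §3 What a refutation must prove -/

/-- **The negation of the crux, unfolded (pure logic).** `¬ crux` says: along EVERY positive sequence `ν_j → 0` and
for all `E`, `ε > 0`, some `j` has, for INFINITELY MANY resolutions `N`, only quiet (`ν_j‖∇U‖² < ε`) admissible
states of energy `≤ E` — a uniform-in-`N` laminarisation theorem for bounded steady Galerkin Taylor–Green states
(route CoherentStates' `SteadyNeg` at the Galerkin level, for this force). Nothing of the kind is known in 3-D.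
[folklore] -/
theorem not_crux_iff :
    ¬ Summit.AnomalousDissipation.AnomalousDissipation.Theses.MirrorVariety.TaylorGreenLoudGalerkinStates ↔
      ∀ (ν : ℕ → ℝ) (E ε : ℝ), (∀ j, 0 < ν j) → Tendsto ν atTop (𝓝 0) → 0 < ε →
        ∃ j, ∃ᶠ N in atTop, ∀ U : UnitAddTorus (Fin 3) → EuclideanSpace ℝ (Fin 3),
          IsSteadyState (ν j) N tgForce U → ∫ x, ‖U x‖ ^ 2 ≤ E → ν j * gradNormSq U < ε := by
  rw [crux_iff]
  constructor
  · intro h ν E ε hν hlim hε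
    by_contra hc
    refine h ⟨ν, E, ε, hν, hlim, hε, fun j => ?_⟩
    have hj : ¬ ∃ᶠ N in atTop, ∀ U : UnitAddTorus (Fin 3) → EuclideanSpace ℝ (Fin 3),
        IsSteadyState (ν j) N tgForce U → ∫ x, ‖U x‖ ^ 2 ≤ E → ν j * gradNormSq U < ε := fun hf => hc ⟨j, hf⟩
    rw [Filter.not_frequently] at hj
    refine hj.mono fun N hN => ?_
    by_contra hU
    refine hN fun U hS hE => ?_
    by_contra hlt
    exact hU ⟨U, hS, hE, not_lt.1 hlt⟩
  · rintro h ⟨ν, E, ε, hν, hlim, hε, hL⟩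
    obtain ⟨j, hj⟩ := h ν E ε hν hlim hε
    obtain ⟨N, ⟨U, hS, hE, hloud⟩, hN⟩ := ((hL j).and_frequently hj).exists
    exact absurd (hN U hS hE) (not_lt.2 hloud)

/-! ## §4a Targets — positive by-product: `stub_tgForceRegular` is TRUE (complete proof)

The line's `stub_tgForceRegular : IsKField tgForce` (smooth ∧ div-free ∧ mean-zero ∧ `K`-symmetric) is not a target
for refutation: it is PROVED — `isSmooth_tgForce`, `isDivFree_tgForce`, `hasZeroMean_tgForce` (§2(b♯), landed in
`Theorems/TaylorGreenLoudGalerkinStates/Negative/Anatomy.lean`) and `isKSymm_tgForce` below, stated against verbatim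
copies of the skeleton's local vocabulary (`reflMat`, `actVec`, `IsKSymm`; `tgForce` here is a `def` with the skeleton's
body, so the two agree by `rfl`). The lead can paste these or restate them in one line each. -/

/-- VERBATIM COPY of the skeleton's `reflMat`: `R_i = diag(1,…,-1 (slot i),…,1) ∈ M₃(ℤ)`. -/
def reflMat (i : Fin 3) : Matrix (Fin 3) (Fin 3) ℤ :=
  Matrix.diagonal fun k => if k = i then -1 else 1

/-- VERBATIM COPY of the skeleton's `actVec`. -/
def actVec (M : Matrix (Fin 3) (Fin 3) ℤ) (v : EuclideanSpace ℝ (Fin 3)) : EuclideanSpace ℝ (Fin 3) :=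
  WithLp.toLp 2 ((M.map (Int.cast : ℤ → ℝ)).mulVec (WithLp.ofLp v))

/-- VERBATIM COPY of the skeleton's `IsKSymm`. -/
def IsKSymm (u : UnitAddTorus (Fin 3) → EuclideanSpace ℝ (Fin 3)) : Prop :=
  ∀ (i : Fin 3) (x : UnitAddTorus (Fin 3)), u (Torus.mulVecT (reflMat i) x) = actVec (reflMat i) (u x)

/-- Coordinates of the reflected torus point: `(R_i x)_l = -x_l` if `l = i`, else `x_l`. [folklore] -/
theorem mulVecT_reflMat_apply (i : Fin 3) (x : UnitAddTorus (Fin 3)) (l : Fin 3) :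
    Torus.mulVecT (reflMat i) x l = if l = i then -x l else x l := by
  rw [Torus.mulVecT_apply]
  simp only [reflMat, Matrix.diagonal_apply, ite_smul, zero_smul, Finset.sum_ite_eq, Finset.mem_univ, if_true]
  split_ifs <;> simp

/-- Coordinates of the reflected vector: `(R_i v)_j = -v_j` if `j = i`, else `v_j`. [folklore] -/
theorem actVec_reflMat_apply (i : Fin 3) (v : EuclideanSpace ℝ (Fin 3)) (j : Fin 3) :
    actVec (reflMat i) v j = if j = i then -v j else v j := by
  simp only [actVec, reflMat, PiLp.toLp_apply, Matrix.mulVec, dotProduct, Matrix.map_apply,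
    Matrix.diagonal_apply]
  simp only [apply_ite (Int.cast : ℤ → ℝ), Int.cast_neg, Int.cast_one, Int.cast_zero, ite_mul, zero_mul,
    Finset.sum_ite_eq, Finset.mem_univ, if_true]
  split_ifs <;> simp

/-- `e(-y) = conj e(y)` for the Fourier characters. [folklore] -/
theorem fourier_neg_arg (n : ℤ) (y : UnitAddCircle) : fourier n (-y) = conj (fourier n y) := by
  rw [← fourier_neg, fourier_apply, fourier_apply, neg_smul, smul_neg]

/-- The reflected torus point, coordinatewise, for each of the three reflections. [folklore] -/
theorem mulVecT_reflMat_coords (x : UnitAddTorus (Fin 3)) :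
    (Torus.mulVecT (reflMat 0) x 0 = -x 0 ∧ Torus.mulVecT (reflMat 0) x 1 = x 1 ∧ Torus.mulVecT (reflMat 0) x 2 = x 2) ∧
    (Torus.mulVecT (reflMat 1) x 0 = x 0 ∧ Torus.mulVecT (reflMat 1) x 1 = -x 1 ∧ Torus.mulVecT (reflMat 1) x 2 = x 2) ∧
    (Torus.mulVecT (reflMat 2) x 0 = x 0 ∧ Torus.mulVecT (reflMat 2) x 1 = x 1 ∧ Torus.mulVecT (reflMat 2) x 2 = -x 2) := by
  refine ⟨⟨?_, ?_, ?_⟩, ⟨?_, ?_, ?_⟩, ⟨?_, ?_, ?_⟩⟩ <;> simp [mulVecT_reflMat_apply]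

/-- The reflected vector, coordinatewise. [folklore] -/
theorem actVec_reflMat_coords (v : EuclideanSpace ℝ (Fin 3)) :
    (actVec (reflMat 0) v 0 = -v 0 ∧ actVec (reflMat 0) v 1 = v 1 ∧ actVec (reflMat 0) v 2 = v 2) ∧
    (actVec (reflMat 1) v 0 = v 0 ∧ actVec (reflMat 1) v 1 = -v 1 ∧ actVec (reflMat 1) v 2 = v 2) ∧
    (actVec (reflMat 2) v 0 = v 0 ∧ actVec (reflMat 2) v 1 = v 1 ∧ actVec (reflMat 2) v 2 = -v 2) := by
  refine ⟨⟨?_, ?_, ?_⟩, ⟨?_, ?_, ?_⟩, ⟨?_, ?_, ?_⟩⟩ <;> simp [actVec_reflMat_apply]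

/-- Components of `f_TG`. [folklore] -/
theorem tgForce_apply_coords (y : UnitAddTorus (Fin 3)) :
    tgForce y 0 = (fourier 1 (y 0) : ℂ).im * (fourier 1 (y 1) : ℂ).re * (fourier 1 (y 2) : ℂ).re ∧
    tgForce y 1 = -((fourier 1 (y 0) : ℂ).re * (fourier 1 (y 1) : ℂ).im * (fourier 1 (y 2) : ℂ).re) ∧
    tgForce y 2 = 0 := by
  refine ⟨?_, ?_, ?_⟩ <;> simp [tgForce]

/-- Extensionality in `ℝ³` by the three coordinates. [folklore] -/
theorem euclid_ext3 {u v : EuclideanSpace ℝ (Fin 3)} (h0 : u 0 = v 0) (h1 : u 1 = v 1) (h2 : u 2 = v 2) :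
    u = v := by
  ext j
  fin_cases j <;> assumption

/-- `f_TG (R_0 x) = R_0 f_TG (x)`. [folklore] -/
theorem tgForce_refl0 (x : UnitAddTorus (Fin 3)) :
    tgForce (Torus.mulVecT (reflMat 0) x) = actVec (reflMat 0) (tgForce x) := by
  obtain ⟨⟨a0, a1, a2⟩, -, -⟩ := mulVecT_reflMat_coords x
  obtain ⟨⟨d0, d1, d2⟩, -, -⟩ := actVec_reflMat_coords (tgForce x)
  obtain ⟨t0, t1, t2⟩ := tgForce_apply_coords x
  obtain ⟨s0, s1, s2⟩ := tgForce_apply_coords (Torus.mulVecT (reflMat 0) x)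
  refine euclid_ext3 ?_ ?_ ?_
  · rw [s0, d0, t0, a0, a1, a2, fourier_neg_arg, Complex.conj_im]; ring
  · rw [s1, d1, t1, a0, a1, a2, fourier_neg_arg, Complex.conj_re]
  · rw [s2, d2, t2]

/-- `f_TG (R_1 x) = R_1 f_TG (x)`. [folklore] -/
theorem tgForce_refl1 (x : UnitAddTorus (Fin 3)) :
    tgForce (Torus.mulVecT (reflMat 1) x) = actVec (reflMat 1) (tgForce x) := by
  obtain ⟨-, ⟨b0, b1, b2⟩, -⟩ := mulVecT_reflMat_coords x
  obtain ⟨-, ⟨e0, e1, e2⟩, -⟩ := actVec_reflMat_coords (tgForce x)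
  obtain ⟨t0, t1, t2⟩ := tgForce_apply_coords x
  obtain ⟨s0, s1, s2⟩ := tgForce_apply_coords (Torus.mulVecT (reflMat 1) x)
  refine euclid_ext3 ?_ ?_ ?_
  · rw [s0, e0, t0, b0, b1, b2, fourier_neg_arg, Complex.conj_re]
  · rw [s1, e1, t1, b0, b1, b2, fourier_neg_arg, Complex.conj_im]; ring
  · rw [s2, e2, t2]

/-- `f_TG (R_2 x) = R_2 f_TG (x)`. [folklore] -/
theorem tgForce_refl2 (x : UnitAddTorus (Fin 3)) :
    tgForce (Torus.mulVecT (reflMat 2) x) = actVec (reflMat 2) (tgForce x) := by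
  obtain ⟨-, -, ⟨c0, c1, c2⟩⟩ := mulVecT_reflMat_coords x
  obtain ⟨-, -, ⟨g0, g1, g2⟩⟩ := actVec_reflMat_coords (tgForce x)
  obtain ⟨t0, t1, t2⟩ := tgForce_apply_coords x
  obtain ⟨s0, s1, s2⟩ := tgForce_apply_coords (Torus.mulVecT (reflMat 2) x)
  refine euclid_ext3 ?_ ?_ ?_
  · rw [s0, g0, t0, c0, c1, c2, fourier_neg_arg, Complex.conj_re]
  · rw [s1, g1, t1, c0, c1, c2, fourier_neg_arg, Complex.conj_re]
  · rw [s2, g2, t2, neg_zero]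

/-- **`f_TG` is `K`-symmetric**: `f_TG (R_i x) = R_i f_TG (x)` for the three coordinate reflections
(`sin` odd, `cos` even). [folklore] -/
theorem isKSymm_tgForce : IsKSymm tgForce := by
  intro i x
  fin_cases i
  · exact tgForce_refl0 x
  · exact tgForce_refl1 x
  · exact tgForce_refl2 x


/-! ## §4 Targets — line `stagnation-plug-froth` (lead `prover-line-stmt-AnomalousDissipation-2987-lean-0`)

No stuck stubs were handed to this seat yet (`payload.targets = []`). Hand audit of the four typed stubs of
`Cruxes/TaylorGreenLoudGalerkinStates/Lines/stagnation-plug-froth.lean` (cycle 1), looking for junk instances: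

* `stub_tgForceRegular : IsKField tgForce` — TRUE and PROVED here (§2(b♯) `isSmooth/isDivFree/hasZeroMean_tgForce`,
  §4a `isKSymm_tgForce`). Not a target; a free lemma for the lead.
* `stub_criticality` — TRUE as typed: for `K`-symmetric smooth `f` and a `K`-field `U`, `testedForm ν f U (ρ_g a) =
  testedForm ν f U a` by the measure-preserving change of variables `x ↦ R_g x`, `testedForm` is linear in the smooth test
  `a`, and the `K`-average of a band-limited smooth div-free test is again one (`|R_g k| = |k|`, `R_g 0 = 0`); note the
  conclusion's tests are automatically mean-zero (band-limited to the PUNCTURED ball), so no mean-zero gap. `f` need not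
  be div-free — harmless (only `∫⟪f, a⟫` with div-free `a` enters). Not a target.
* `stub_galerkinNewton` — no junk instance found: `v = 0` forces `ε₁ ≤ 0`, then `ν(Mη)² ≤ cε₁` forces `ε₁ = 0 ∧ Mη = 0`,
  and the conclusion is met by `U = 0` whenever the residual hypothesis makes `∫⟪f,a⟫ = 0` on `K`-fields; `E₁ = 0` forces
  `v = 0`; `M = 0` makes the inf-sup hypothesis unsatisfiable (take any `w ≠ 0`); `M < 0` acts as `|M|` (`linForm` is odd in
  `a`); non-`K`-symmetric `f` is invisible to `K`-tests on both sides. Substance = Newton–Kantorovich in `V_K` (`H¹`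
  `K`-fields) with `β = M`, residual `Mη`, and Lipschitz constant of `DF` equal to that of the trilinear form,
  `2C_B` (Sobolev on mean-zero fields of `T³`), INDEPENDENT of `ν` — so a universal `c = min(1/4C_B, 1/16, π²)` is
  consistent with the margins `4E₁`, `ε₁/4`; then BRR (Stokes isomorphism + compact perturbation ⇒ discrete inf-sup for
  `N ≥ N₀(u,ν)`, `U_N → u` in `H¹`, strict margins when `E₁ > 0`, trivial when `E₁ = 0`). One-sided inf-sup suffices
  (Fredholm index `0`). TRUE in print; XL in Lean. Not a cheap target; if the lead gets stuck it will be on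
  infrastructure (discrete inf-sup), not on falsity.
* v2 STUBS (lead r-0, 2026-08-16T01:44Z; `stub_galerkinNewton` decomposed; vocabulary landed in
  `Theorems/MirrorVarietyTaylorGreenLoudGalerkinStatesLine.lean`, which imports `Negative.LoadBearing`):
  - `stub_truncation` (P_N v inherits `K`-field-ness, band-limitation to the PUNCTURED ball — fine because `v` is mean-zero so
    `(P_N v)^(0) = 0` —, energy `≤ E₁` (Bessel), loudness `≥ ε₁/2` eventually (monotone convergence of the truncated enstrophy; the
    case `ε₁ ≤ 0` is harmless), residual `≤ (η + δE₁)√‖∇a‖²` on band-limited `K`-tests: the Stokes part of the truncation error is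
    EXACTLY zero against band-limited tests (orthogonality) and the trilinear part is `≤ (‖v − P_N v‖₂‖P_N v‖_∞ + ‖v‖_∞‖v − P_N v‖₂)‖∇a‖
    → 0`, absorbed by `δE₁` when `E₁ > 0`, while `E₁ = 0 ⇒ v = 0` and `E₁ < 0` is vacuous): TRUE, no junk instance.
  - `stub_discreteInfSup` (continuous one-sided inf-sup `M` on `K`-fields ⇒ discrete inf-sup `2M` on band-limited `K`-fields at `P_N v`
    for large `N`): Stokes part = `−ν ×` Riesz map (perfectly Galerkin-stable), linearised convection compact, Fourier truncation = the
    `H¹`-orthogonal projection commuting with `K` ⇒ projection method for a second-kind equation (Kress-type stability) + `‖T_{P_N v} − T_v‖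
    → 0`; `M = 0` unsatisfiable whenever a nonzero band-limited `K`-field exists, and for `N ≤ 1` there is NONE (`K`-symmetry kills the
    modes `±e_i`), where both sides degenerate consistently: TRUE, no junk instance.
  - `stub_discreteKantorovich` (finite-dimensional Newton–Kantorovich at fixed `N` with a universal `c`): Lipschitz constant of `DF_N` in
    the `‖∇·‖` metric = trilinear constant `2C_B` of `T³` (mean-zero fields), independent of `N, ν` ⇒ `c = min(1/4C_B, (1−1/√2)²/4, …)`
    gives `∫|U|² ≤ 2E`, `ν‖∇U‖² ≥ ε/2`; degenerate data (`E = 0`, `ε ≤ 0`, `V_N^K = {0}` for `N ≤ 1`) all consistent: TRUE, no junk instance.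
  - JOINT SUFFICIENCY with `stub_froth`: choose `c_froth = c/8` and `δ ≤ c/(8M_j²E₁)` (δ is fixed before the `∀ᶠ N` of truncation):
    `(2M_j)²(η_j + δE₁) ≤ c`, `((2M_j)(η_j+δE₁))² ≤ cE₁`, `ν_j(2M_j(η_j+δE₁))² ≤ c·ε₁/2` ⇒ Kantorovich returns `∫|U|² ≤ 2E₁ ≤ 4E₁` and
    `ν_j‖∇U‖² ≥ (ε₁/2)/2 = ε₁/4` — exactly `stub_galerkinNewton`'s margins. The decomposition is sound; no gap smuggled by the glue.
* `stub_froth` (heart) — equivalent, via Kantorovich with small `c`, to "nondegenerate `K`-symmetric bounded loud EXACT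
  steady states along `ν_j → 0⁺`" = the steady zeroth law for `f_TG` in the `K`-class: the crux's open content. The only
  conceivable kills are (i) a 3-D laminarisation theorem (none exists; §3), (ii) an obstruction specific to the `K`-class
  (impermeable walls `x_i ∈ {0, ½}` confine the flow to cubes but forbid nothing about dissipation). No kill.

## §5 Why the crux resists (for ideators/planners)

1. LOGICAL SHAPE: `∃ ν_j, ∃ E ε, ∀ j, ∀ᶠ N, ∃ U`. Every finite family of `(ν, N)`-computations is consistent with it
   (free constants, free sequence, cofinitely many `N`); only a THEOREM refutes it, and by `not_crux_iff` that theorem is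
   uniform-in-`N` laminarisation of bounded steady Galerkin TG states — open (3-D; the 2-D/planar version is the
   Alexakis–Doering barrier, evaded by `f_TG`). The planner's kill chain would be: `CoherentStates.SteadyNeg` (stmt-0222, open)
   ∧ `FixedViscosityTransfer` (2991) ∧ regularity of steady weak solutions (tree: `Temam1979_steadyWeakSolution_smooth_holds`)
   ∧ pressure recovery ⟹ `¬ crux`; only the first link is missing, and it is the whole difficulty.
2. WHAT IS PINNED DOWN (this file): injection identity ⇒ `ε ≤ ½√E` (sharp); Bernstein ⇒ witnesses need
   `N_j ≳ (ε/Eν_j)^{1/2}`, enstrophy at `|k| > (ε/8π²νE)^{1/2}` (`high_mode_dissipation_floor`) while `∫⟪f_TG,U⟫ ≥ ε` keeps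
   `≥ 4ε²` energy on the forcing shell `|k|² = 3` (`shell_energy_floor`) — a steady cascade, no contradiction.
3. NUMERICAL EVIDENCE (kit j008370, j009031, j014549, j014887; files `numerics-j009031.md`, `j009031_branch.csv`,
   `j014549_branch.csv`, `j014887_branch3.csv` attached to the item; evidence, not proof). The laminar `K`-symmetric steady branch was
   continued in `ν` from Stokes (`ν = 0.1`) to `ν = 0.0015` (`Re := √E/ν ≈ 450`) at fixed force: exact dealiased Galerkin; dense Newton
   (`N = 4, 6`), Newton–GMRES (`N = 8, 12, 16`, spot `20`) and finally `K`-SYMMETRISED Newton–GMRES (residual and Krylov vectors projected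
   on the `K`-subspace, which removes the symmetry-breaking singularities that stalled the plain solver at `ν = 0.00267`); `|f̂|² = 0.2500`,
   injection `= D`, full residual `≤ 8e-10`, `N = 12/16` agree to 6 digits for `ν ≥ 0.0084` and to 1–2 % at `ν = 0.0018`.
   BRANCH: `ν = 0.02, 0.00633, 0.00343, 0.00248, 0.00179` ↦ `Re = 10, 70, 154, 240, 374`, `E = 0.043, 0.194, 0.277, 0.355, 0.447`,
   `D = 0.103, 0.202, 0.224, 0.249, 0.277` (`A := 4D`, the component of `U` along `f`: `0.41 → 1.11`; Stokes would give `4.7` at the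
   last point), `β := D/E^{3/2} = 11.7 → 0.93`, `ν²E ↓ 0`.
   LOCAL EXPONENTS: a KNEE at `Re ≈ 100–150` (`d log E/d log ν = −0.51`, `d log D/d log ν = −0.13` at `Re = 124`, where `det DF` also
   flips sign repeatedly — reorganisation of the cell), after which the growth RESUMES at the PRANDTL-LAYER RATES, stable over `Re = 190–370`:
   `E ∝ ν^{−0.70±0.03}`, `D ∝ ν^{−0.32±0.02}`, `β ∝ Re^{−0.53±0.03}`, `u_max ∝ ν^{−0.45}` (laminar law `U ∝ ν^{−1/3}`: `E ∝ ν^{−2/3}`,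
   `D ∝ ν^{−1/3}`, `β ∝ Re^{−1/2}`). READING: the laminar branch is a FRUSTRATED RUNAWAY — energy diverging like `ν^{−2/3}` (far slower
   than Stokes' `ν^{−2}`) while LAMINARISING in the Doering–Foias sense (`β → 0` like `Re^{−1/2}`); the alternative "saturation" reading
   (`A → A∞`, `E → E∞`: loud bounded laminar states on the primary Stokes curve, as ideator 1's `symmetric-stokes-curve-standing-cascade`
   proposes) is DISFAVOURED by the data to `Re ≈ 450` (and constrained in print: a bounded `BV`-type limit carries no dissipation by
   `Literature.Barriers.AnomalousDissipation.DeRosaInversi2024_thm12`, an `L³B^{σ>1/3}_{3,∞}` one none by `DrivasEyink2019_lemma1`, so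
   saturation would need multiplying internal layers — unbounded total variation — beyond `Re ≈ 450`). CONSEQUENCE: at fixed force the laminar
   branch leaves every energy ball `{∫|U|² ≤ E₀}` (at `ν ≈ 0.0018·(0.45/E₀)^{1.4}` by the fitted law) and supplies NO crux witnesses;
   ideator 2's deflated-Newton census (300–400 random seeds, `ν = 0.01/0.005/0.003`, `NotesIdeator2g2.md`) found no other steady state in
   the `K`-class, and cross-validates the branch (`(E, W) = (0.222, 0.210)` at `ν = 0.00514`). Witnesses, if any, must live on the
   symmetry-breaking branches born at `Re ≈ 40–150` (loudness unknown) or beyond `Re ≈ 450`; at `ν = 0.002` the laminar state is already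
   dynamically unstable (RK4 leaves it). None of this refutes `∃ ν_j, ∀ᶠ N …`; it says where witnesses are NOT.
4. NEXT ATTACKS: (i) the symmetry-breaking branches (deflated / arclength continuation off the laminar branch at the `det DF` flips, `N = 12–16`): are THEY loud at bounded energy? (ii) stuck stubs of the lead when handed over;
   (iii) literature on steady cellular-flow layers (Childress 1979 flux expulsion; Prandtl–Batchelor in 3-D cells) for a printed
   version of the `ν^{−1/3}` law, which would make item 3 citable rather than numerical.
-/

end Summit.AnomalousDissipation.AnomalousDissipation.Cruxes.TaylorGreenLoudGalerkinStates.Disproof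

end
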